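import Summits.Ventures.HSemireg.WedgeHankelRecurrenceGaussChebyshevComposition

/-!
# Venture HSemireg — **A COMMON ROOT KILLS THE RESULTANT IN EVERY FORMAL DEGREE**, and the odd–odd Chebyshev cases: for `f(r) = g(r) = 0` over a domain, **`Res_{(m,n)}(f, g) = 0`** whenever
# `deg f ≤ m`, `0 < m`, `deg g ≤ n`; hence for odd `m`, `n` (common zero `0`) **`Res_{(m,n)}(T_m, T_n) = Res_{(m,n)}(U_m, U_n) = Res_{(m,n)}(T_m, U_n) = 0`** over `ℤ`

HONEST FRAMING. Part of the Lean index of the computation cell `pub-hsemireg` (seat p10 gen 47, Sunday typer «UNIFORM-IN-n»).  Polynomial algebra only (Mathlib `Polynomial.resultant`,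
`Polynomial.Chebyshev`); no variety, no cohomology theory, no sheaf, no Ext group and no semiregularity map is constructed here; nothing here says that HC / HC_CM / HC_AV holds; no Literature
fact (unproved `Prop`) is declared or used.  Custodian versions as in `WedgeHankelSiegelIdeal` (1/3).
SOURCES (cited).  I. M. Gelfand, M. M. Kapranov, A. V. Zelevinsky, *Discriminants, Resultants, and Multidimensional Determinants* (1994), Ch. 12 §1 (a common root annihilates the Sylvester
resultant); K. Dilcher, K. B. Stolarsky, Trans. Amer. Math. Soc. 357 (2005) 965–981, Thm 2 ∕ Thm 3 (vanishing pattern of `Res(T_m, T_n)`, `Res(U_m, U_n)`).  The odd–odd cases are COROLLARIES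
typed here.
PROOF TYPED HERE.  `f = (X − r) f'` (Mathlib `dvd_iff_isRoot`), formal-degree padding `resultant_add_left_deg`, `resultant_mul_left`, `resultant_X_sub_C_left` (`= g(r) = 0`); the case `f = 0` by
`resultant_zero_left`; Mathlib `T_eval_zero_of_odd`, `U_eval_zero_of_odd`, `natDegree_T`, `natDegree_U_natCast`.
DEDUP DISCLOSURE (`rg -n -i 'common_root|resultant_odd_odd' Summits/Ventures/HSemireg`, 2026-09-04): N421 (`common_zero_gap_two_iff`, recurrences); Mathlib `resultant_eq_zero_iff` (fields, natural
formal degrees only); 0 hits for the 4 names below.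

WHAT IS IN THE TREE.  Mathlib `dvd_iff_isRoot`, `resultant_add_left_deg`, `resultant_mul_left`, `resultant_X_sub_C_left`, `resultant_zero_left`; N433 `chebyshevT_resultant_T_odd_mul` (the
other vanishing family).
THIS FILE (namespace `Summit.Ventures.HSemireg.Wedge.HankelOuter` continued; CHAINED on N433; 0 definitions):
* §1199 **`resultant_eq_zero_of_common_root`**, `chebyshevT_resultant_odd_odd`, `chebyshevU_resultant_odd_odd`, `chebyshevTU_resultant_odd_odd`.
CAVEATS.  Domain coefficients; `0 < m` excludes the degenerate `Res_{(0,0)} = 1`.  Nothing Ext-side.  New names only.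
-/

open Module Polynomial
open scoped Matrix Polynomial

namespace Summit.Ventures.HSemireg.Wedge.HankelOuter

/-! ## §1199. Common roots and the odd–odd Chebyshev resultants -/

/-- **A common root annihilates the resultant in every admissible formal degree:** `f(r) = g(r) = 0`, `deg f ≤ m`, `0 < m`, `deg g ≤ n` `⇒ Res_{(m,n)}(f, g) = 0` (domain). [GKZ Ch. 12 §1;
this file, §1199] -/
theorem resultant_eq_zero_of_common_root {R : Type*} [CommRing R] [IsDomain R] {f g : R[X]} {r : R} (hf : f.eval r = 0) (hg : g.eval r = 0) {m n : ℕ}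
    (hm : f.natDegree ≤ m) (hm0 : 0 < m) (hn : g.natDegree ≤ n) : f.resultant g m n = 0 := by
  by_cases hf0 : f = 0
  · subst hf0
    rcases Nat.eq_zero_or_pos n with rfl | hn0
    · have hc : g.coeff 0 = 0 := by
        have e := eq_C_of_natDegree_le_zero hn
        rw [e, eval_C] at hg
        exact hg
      rw [resultant_zero_left, hc, zero_pow hm0.ne', mul_zero]
    · rw [resultant_zero_left, zero_pow hn0.ne', zero_mul]
  obtain ⟨f', hf'⟩ := dvd_iff_isRoot.2 hf
  have hf'0 : f' ≠ 0 := by rintro rfl; exact hf0 (by rw [hf', mul_zero])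
  obtain ⟨k, hk⟩ := Nat.exists_eq_add_of_le hm
  rw [hk, resultant_add_left_deg _ _ _ _ _ le_rfl, hf', natDegree_mul (X_sub_C_ne_zero r) hf'0, resultant_mul_left _ _ _ n hn, natDegree_X_sub_C,
    resultant_X_sub_C_left _ _ _ hn, hg, zero_mul, mul_zero]

/-- **Odd `m`, `n`: `Res_{(m,n)}(T_m, T_n) = 0`** over `ℤ` (common zero `0`). [Dilcher–Stolarsky 2005 Thm 2; this file, §1199] -/
theorem chebyshevT_resultant_odd_odd {m n : ℕ} (hm : Odd m) (hn : Odd n) :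
    (Polynomial.Chebyshev.T ℤ (m : ℤ)).resultant (Polynomial.Chebyshev.T ℤ (n : ℤ)) m n = 0 :=
  resultant_eq_zero_of_common_root (Polynomial.Chebyshev.T_eval_zero_of_odd ℤ (Odd.natCast hm)) (Polynomial.Chebyshev.T_eval_zero_of_odd ℤ (Odd.natCast hn))
    (by rw [Polynomial.Chebyshev.natDegree_T, Int.natAbs_natCast]) hm.pos (by rw [Polynomial.Chebyshev.natDegree_T, Int.natAbs_natCast])

/-- **Odd `m`, `n`: `Res_{(m,n)}(U_m, U_n) = 0`** over `ℤ` (common zero `0`). [Dilcher–Stolarsky 2005 Thm 3; this file, §1199] -/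
theorem chebyshevU_resultant_odd_odd {m n : ℕ} (hm : Odd m) (hn : Odd n) :
    (Polynomial.Chebyshev.U ℤ (m : ℤ)).resultant (Polynomial.Chebyshev.U ℤ (n : ℤ)) m n = 0 :=
  resultant_eq_zero_of_common_root (Polynomial.Chebyshev.U_eval_zero_of_odd ℤ (Odd.natCast hm)) (Polynomial.Chebyshev.U_eval_zero_of_odd ℤ (Odd.natCast hn))
    (Polynomial.Chebyshev.natDegree_U_natCast ℤ m).le hm.pos (Polynomial.Chebyshev.natDegree_U_natCast ℤ n).le

/-- **Odd `m`, `n`: `Res_{(m,n)}(T_m, U_n) = 0`** over `ℤ` (common zero `0`). [corollary; this file, §1199] -/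
theorem chebyshevTU_resultant_odd_odd {m n : ℕ} (hm : Odd m) (hn : Odd n) :
    (Polynomial.Chebyshev.T ℤ (m : ℤ)).resultant (Polynomial.Chebyshev.U ℤ (n : ℤ)) m n = 0 :=
  resultant_eq_zero_of_common_root (Polynomial.Chebyshev.T_eval_zero_of_odd ℤ (Odd.natCast hm)) (Polynomial.Chebyshev.U_eval_zero_of_odd ℤ (Odd.natCast hn))
    (by rw [Polynomial.Chebyshev.natDegree_T, Int.natAbs_natCast]) hm.pos (Polynomial.Chebyshev.natDegree_U_natCast ℤ n).le

end Summit.Ventures.HSemireg.Wedge.HankelOuter
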